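import Mathlib
import Summits.Ventures.PercRepro2.Defs
import Summits.Ventures.PercRepro2.Independence
import Summits.Ventures.PercRepro2.Harris
import Summits.Ventures.PercRepro2.Graph
import Summits.Ventures.PercRepro2.Exploration
import Summits.Ventures.PercRepro2.Events
import Summits.Ventures.PercRepro2.Induced
import Summits.Ventures.PercRepro2.BoxUnionDefs
import Summits.Ventures.PercRepro2.BoxUnion
import Summits.Ventures.PercRepro2.BoxUnionPair
import Summits.Ventures.PercRepro2.PairTP2
import Summits.Ventures.PercRepro2.PairTP2Main
import Summits.Ventures.PercRepro2.SeparatedDefs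
import Summits.Ventures.PercRepro2.SeparatedPair
import Summits.Ventures.PercRepro2.PairTP2BroomLemmas
import Summits.Ventures.PercRepro2.PairTP2Broom

/-!
# (PAIR-TP2), the (⟹) direction — part 3: the grid events and the weights of a broom
(blind cell PercRepro2, mine-1 g39; proofs/MINE1-PAIRTP2.md §2′ without walks)

On the configurations agreeing with the broom `ω₁` off `f_s, g, f_t`, the grid events `(S,T)`,
`(N,N)`, `(N,T)`, `(S,N)` are exactly the local configurations `(1,0,1)`, `(0,·,0)`, `(0,0,1)`,
`(1,0,0)` (`mem_gridEvent_ST` … `mem_gridEvent_SN`). The local configurations `loc x` and the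
weight vector `wt a b d` (`a, b, d` on `f_s, g, f_t`; `1` / `0` on the other open / closed edges
of `ω₁`) are defined here; the masses are computed in `PairTP2BroomMass`.
-/

namespace Summit.Ventures.PercRepro2

namespace PairTP2Broom

open Finset
open scoped Classical

variable {V : Type*} {E : Type*} {ends : E → Sym2 V}

variable [DecidableEq E] {s t u v : V}

namespace Broom
/-! ### The four grid events on the agreeing configurations -/

section Grid

variable [Fintype V] [DecidableEq V] [Fintype E]

/-- `(S, T)` on the agreeing configurations is exactly `(1, 0, 1)`. -/
lemma mem_gridEvent_ST (B : Broom ends s t u v) {ω : Config E} (hA : B.Agrees ω) :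
    ω ∈ PairTP2.gridEvent ends s t u v (2, 0) ↔
      ω B.fs = true ∧ ω B.g = false ∧ ω B.ft = true := by
  rw [PairTP2.mem_gridEvent, PairTP2.code_eq_two_iff, PairTP2.code_eq_zero_iff]
  constructor
  · rintro ⟨hsu, ⟨hsv, htv⟩, hQ⟩
    have h1 : ω B.fs = true := by
      by_contra h0
      exact B.hus (B.eq_s_of_conn hA (by simpa using h0) hsu)
    have h3 : ω B.ft = true := by
      by_contra h0
      exact B.hvt (B.eq_t_of_conn hA (by simpa using h0) htv)
    refine ⟨h1, ?_, h3⟩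
    by_contra h2
    exact hQ (B.conn_st_of_all_open hA h1 (by simpa using h2) h3)
  · rintro ⟨h1, h2, h3⟩
    have hsu := B.conn_su hA h1
    have htv := B.conn_tv hA h3
    refine ⟨hsu, ⟨fun hsv => B.not_conn_uv hA h2 (conn_trans (conn_symm hsu) hsv), htv⟩, ?_⟩
    intro hst
    exact B.not_conn_uv hA h2 (conn_trans (conn_symm hsu) (conn_trans hst htv))

/-- `(N, N)` on the agreeing configurations is exactly `f_s, f_t` closed (`g` free). -/
lemma mem_gridEvent_NN (B : Broom ends s t u v) {ω : Config E} (hA : B.Agrees ω) :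
    ω ∈ PairTP2.gridEvent ends s t u v (1, 1) ↔ ω B.fs = false ∧ ω B.ft = false := by
  rw [PairTP2.mem_gridEvent, code_eq_one_iff' s t, code_eq_one_iff' s t]
  constructor
  · rintro ⟨⟨hsu, -⟩, ⟨-, htv⟩, -⟩
    constructor
    · by_contra h1
      exact hsu (B.conn_su hA (by simpa using h1))
    · by_contra h3
      exact htv (B.conn_tv hA (by simpa using h3))
  · rintro ⟨h0, h0'⟩
    refine ⟨⟨fun h => B.hus (B.eq_s_of_conn hA h0 h), fun h => B.hut (B.eq_t_of_conn hA h0' h)⟩,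
      ⟨fun h => B.hvs (B.eq_s_of_conn hA h0 h), fun h => B.hvt (B.eq_t_of_conn hA h0' h)⟩, ?_⟩
    intro h
    exact B.s_ne_t (B.eq_s_of_conn hA h0 h).symm

/-- `(N, T)` on the agreeing configurations is exactly `(0, 0, 1)`. -/
lemma mem_gridEvent_NT (B : Broom ends s t u v) {ω : Config E} (hA : B.Agrees ω) :
    ω ∈ PairTP2.gridEvent ends s t u v (1, 0) ↔
      ω B.fs = false ∧ ω B.g = false ∧ ω B.ft = true := by
  rw [PairTP2.mem_gridEvent, code_eq_one_iff' s t, PairTP2.code_eq_zero_iff]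
  constructor
  · rintro ⟨⟨hsu, htu⟩, ⟨-, htv⟩, -⟩
    have h0 : ω B.fs = false := by
      by_contra h1
      exact hsu (B.conn_su hA (by simpa using h1))
    have h3 : ω B.ft = true := by
      by_contra h0'
      exact B.hvt (B.eq_t_of_conn hA (by simpa using h0') htv)
    refine ⟨h0, ?_, h3⟩
    by_contra h2
    exact htu (conn_trans htv (conn_symm (B.conn_uv_of_fs_closed hA h0 (by simpa using h2) h3)))
  · rintro ⟨h0, h2, h3⟩
    have htv := B.conn_tv hA h3
    refine ⟨⟨fun h => B.hus (B.eq_s_of_conn hA h0 h),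
      fun htu => B.not_conn_uv hA h2 (conn_trans (conn_symm htu) htv)⟩,
      ⟨fun h => B.hvs (B.eq_s_of_conn hA h0 h), htv⟩, ?_⟩
    intro h
    exact B.s_ne_t (B.eq_s_of_conn hA h0 h).symm

/-- `(S, N)` on the agreeing configurations is exactly `(1, 0, 0)`. -/
lemma mem_gridEvent_SN (B : Broom ends s t u v) {ω : Config E} (hA : B.Agrees ω) :
    ω ∈ PairTP2.gridEvent ends s t u v (2, 1) ↔
      ω B.fs = true ∧ ω B.g = false ∧ ω B.ft = false := by
  rw [PairTP2.mem_gridEvent, PairTP2.code_eq_two_iff, code_eq_one_iff' s t]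
  constructor
  · rintro ⟨hsu, ⟨hsv, htv⟩, -⟩
    have h1 : ω B.fs = true := by
      by_contra h0
      exact B.hus (B.eq_s_of_conn hA (by simpa using h0) hsu)
    have h0 : ω B.ft = false := by
      by_contra h3
      exact htv (B.conn_tv hA (by simpa using h3))
    refine ⟨h1, ?_, h0⟩
    by_contra h2
    exact hsv (conn_trans hsu (B.conn_uv_of_ft_closed hA h1 (by simpa using h2) h0))
  · rintro ⟨h1, h2, h0⟩
    have hsu := B.conn_su hA h1
    refine ⟨hsu, ⟨fun hsv => B.not_conn_uv hA h2 (conn_trans (conn_symm hsu) hsv),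
      fun h => B.hvt (B.eq_t_of_conn hA h0 h)⟩, ?_⟩
    intro h
    exact B.s_ne_t (B.eq_t_of_conn hA h0 (conn_symm h))

end Grid


/-! ### The local configurations and the weights -/

/-- The local configuration `x = (x_s, x_g, x_t)` on the broom. -/
def loc (B : Broom ends s t u v) (x : Bool × Bool × Bool) : Config E :=
  fun e => if e = B.fs then x.1 else if e = B.g then x.2.1 else if e = B.ft then x.2.2 else B.ω₁ e

/-- `loc` at `f_s`. -/
lemma loc_fs (B : Broom ends s t u v) (x : Bool × Bool × Bool) : B.loc x B.fs = x.1 := by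
  simp [loc]

/-- `loc` at `g`. -/
lemma loc_g (B : Broom ends s t u v) (x : Bool × Bool × Bool) : B.loc x B.g = x.2.1 := by
  simp [loc, B.fs_ne_g.symm]

/-- `loc` at `f_t`. -/
lemma loc_ft (B : Broom ends s t u v) (x : Bool × Bool × Bool) : B.loc x B.ft = x.2.2 := by
  simp [loc, B.fs_ne_ft.symm, B.ft_ne_g]

/-- `loc` off the three edges. -/
lemma loc_of_ne (B : Broom ends s t u v) (x : Bool × Bool × Bool) {e : E} (h1 : e ≠ B.fs)
    (h2 : e ≠ B.g) (h3 : e ≠ B.ft) : B.loc x e = B.ω₁ e := by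
  simp [loc, h1, h2, h3]

/-- `loc x` agrees with the broom. -/
lemma agrees_loc (B : Broom ends s t u v) (x : Bool × Bool × Bool) : B.Agrees (B.loc x) :=
  fun _ h1 h2 h3 => B.loc_of_ne x h1 h2 h3

/-- An agreeing configuration is the `loc` of its values on the three edges. -/
lemma eq_loc (B : Broom ends s t u v) {ω : Config E} (hA : B.Agrees ω) :
    ω = B.loc (ω B.fs, ω B.g, ω B.ft) := by
  funext e
  simp only [loc]
  split_ifs with h1 h2 h3
  · rw [h1]
  · rw [h2]
  · rw [h3]
  · exact hA e h1 h2 h3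

/-- The weight vector: `a, b, d` on `f_s, g, f_t`; `1` on the other open edges of `ω₁` and `0`
on its closed edges. -/
noncomputable def wt (B : Broom ends s t u v) (a b d : ℝ) : E → ℝ :=
  fun e => if e = B.fs then a else if e = B.g then b else if e = B.ft then d else
    if B.ω₁ e = true then 1 else 0

/-- `wt` at `f_s`. -/
lemma wt_fs (B : Broom ends s t u v) (a b d : ℝ) : B.wt a b d B.fs = a := by simp [wt]

/-- `wt` at `g`. -/
lemma wt_g (B : Broom ends s t u v) (a b d : ℝ) : B.wt a b d B.g = b := by
  simp [wt, B.fs_ne_g.symm]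

/-- `wt` at `f_t`. -/
lemma wt_ft (B : Broom ends s t u v) (a b d : ℝ) : B.wt a b d B.ft = d := by
  simp [wt, B.fs_ne_ft.symm, B.ft_ne_g]

/-- `wt` off the three edges. -/
lemma wt_of_ne (B : Broom ends s t u v) (a b d : ℝ) {e : E} (h1 : e ≠ B.fs) (h2 : e ≠ B.g)
    (h3 : e ≠ B.ft) : B.wt a b d e = if B.ω₁ e = true then 1 else 0 := by
  simp [wt, h1, h2, h3]

/-- The weights are admissible for `a, b, d ∈ [0, 1]`. -/
lemma isProbVec_wt (B : Broom ends s t u v) {a b d : ℝ} (ha : 0 ≤ a ∧ a ≤ 1) (hb : 0 ≤ b ∧ b ≤ 1)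
    (hd : 0 ≤ d ∧ d ≤ 1) : IsProbVec (B.wt a b d) := by
  constructor
  · intro e
    simp only [wt]
    split_ifs <;> linarith [ha.1, hb.1, hd.1]
  · intro e
    simp only [wt]
    split_ifs <;> linarith [ha.2, hb.2, hd.2]

end Broom

end PairTP2Broom

end Summit.Ventures.PercRepro2
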